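import Summits.QuantumFields.GaugeBoot.LoopEquation
import HarnessLib

/-!
# Loop-equation schema: occurrence detection on `ℤ^d` and one-line instantiation of rows (cell `gauge-boot`, L1, schema)

Honest framing (cell rule): certified bounds on lattice expectations at stated coupling, gauge group, dimension and
torus size; NOT a mass gap, NOT a continuum limit, NOT a string tension; not summit-bearing
(`FixedCouplingUltralocality`, `PerturbativeInvisibility`).

The loop equation of `LoopEquation.lean` has split terms `splitTerm_k` whose case distinction ("does the `k`-th letter
traverse the edge `(x, μ)`?") is a SITE equality on the torus `(ℤ/L)^d` and so depends on `L`.  For the generators'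
rows (eng1/eng2 `leq/1`: fixed words, all `L ≥ L₀`) this file decides it ON `ℤ^d`:
* `Word.dispZ w k : Fin d → ℤ` — the integer displacement after `k` letters; `Word.siteAt_eq_add_castZ`;
* `Word.Small w L` (all partial displacements `≤ L − 2` in sup-norm) ⇒ returns to `x` / to `x + e_μ` on the torus are
  exactly the returns on `ℤ^d` (`Word.siteAt_eq_iff`, `Word.siteAt_sub_eq_iff`); `Word.DispBound w B` is DECIDABLE for
  explicit words and `Word.small_of_dispBound : DispBound B → B + 2 ≤ L → Small L`;
* `Word.fwdOccZ / bwdOccZ` — decidable occurrence predicates; `splitTerm_eq_of_small`;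
* `loopEquation_schema` / `loopEquation_schema_specialUnitaryGroup` — the loop equation with the split sums taken
  over the COMPUTED occurrence sets `(range |w|).filter (fwdOccZ w μ)` / `… bwdOccZ …`: every row of a certificate's
  `𝓔` is one instantiation (word, marked axis `μ`, `decide` for the occurrence sets and the displacement bound), the
  remaining identification of prefix/suffix/plaquette-extended words with canonical loop classes being the word
  symmetries of `GaugeBoot/WordLoop.lean` / `LoopClasses.lean` (lean1).
Everything is `[folklore]`.
-/

noncomputable section

open MeasureTheory Filter Topology NormedSpace
open scoped Matrix.Norms.Frobenius Matrix
open Literature.MathematicalPhysics.QuantumFieldTheory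
open Summit.QuantumFields.YangMills.Cruxes.CurvatureAmnesia.WardDefect.SchwingerDyson

namespace Summit.QuantumFields.GaugeBoot

variable {d L N : ℕ} {G : Type} [Group G] {ρ : G →* Matrix (Fin N) (Fin N) ℂ}

section Schema

open Literature.MathematicalPhysics.QuantumLattice


/-- Integer displacement of a step. [folklore] -/
def Step.dispZ : Step d → (Fin d → ℤ)
  | .fwd μ => Pi.single μ 1
  | .bwd μ => -Pi.single μ 1

/-- Integer displacement (on `ℤ^d`) after the first `k` steps of a word. [folklore] -/
def Word.dispZ (w : Word d) (k : ℕ) : Fin d → ℤ := ((w.take k).map Step.dispZ).sum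

/-- Componentwise cast `ℤ^d → (ℤ/L)^d`. [folklore] -/
def castZ (v : Fin d → ℤ) : Site d L := fun i => (v i : ZMod L)

/-- Unfolding lemma `castZ_zero`. [folklore] -/
@[simp] theorem castZ_zero : castZ (0 : Fin d → ℤ) = (0 : Site d L) := by
  funext i; simp [castZ]

/-- `castZ` is additive. [folklore] -/
theorem castZ_add (u v : Fin d → ℤ) : (castZ (u + v) : Site d L) = castZ u + castZ v := by
  funext i; simp [castZ]

/-- `castZ` commutes with negation. [folklore] -/
theorem castZ_neg (u : Fin d → ℤ) : (castZ (-u) : Site d L) = -castZ u := by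
  funext i; simp [castZ]

/-- `castZ` of a unit vector is the unit vector. [folklore] -/
theorem castZ_single (μ : Fin d) : (castZ (Pi.single μ (1 : ℤ)) : Site d L) = Pi.single μ 1 := by
  funext i
  by_cases h : i = μ
  · subst h; simp [castZ]
  · simp [castZ, h]

/-- A step moves the site by the cast of its integer displacement. [folklore] -/
theorem Step.apply_eq_add_castZ (x : Site d L) (s : Step d) : s.apply x = x + castZ s.dispZ := by
  cases s with
  | fwd μ => simp [Step.apply, Step.dispZ, Site.shift, castZ_single]
  | bwd μ => simp [Step.apply, Step.dispZ, castZ_neg, castZ_single, sub_eq_add_neg]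

/-- Unfolding lemma `Word.dispZ_zero`. [folklore] -/
@[simp] theorem Word.dispZ_zero (w : Word d) : w.dispZ 0 = 0 := by simp [Word.dispZ]

/-- Unfolding lemma `Word.dispZ_nil`. [folklore] -/
@[simp] theorem Word.dispZ_nil (k : ℕ) : Word.dispZ ([] : Word d) k = 0 := by simp [Word.dispZ]

/-- Unfolding lemma `Word.dispZ_cons_succ`. [folklore] -/
@[simp] theorem Word.dispZ_cons_succ (s : Step d) (w : Word d) (k : ℕ) :
    Word.dispZ (s :: w) (k + 1) = s.dispZ + w.dispZ k := by
  simp [Word.dispZ]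

/-- The `k`-th visited site is the base point plus the cast of the integer displacement. [folklore] -/
theorem Word.siteAt_eq_add_castZ (x : Site d L) : ∀ (w : Word d) (k : ℕ),
    Word.siteAt x w k = x + castZ (w.dispZ k)
  | [], k => by simp [Word.siteAt]
  | s :: w, 0 => by simp
  | s :: w, k + 1 => by
    rw [Word.siteAt_succ_cons, Word.siteAt_eq_add_castZ (s.apply x) w k, Word.dispZ_cons_succ, castZ_add,
      Step.apply_eq_add_castZ, add_assoc]

/-- Small integer vectors are determined by their cast mod `L`. [folklore] -/
theorem castZ_eq_castZ_iff {u v : Fin d → ℤ} (h : ∀ i, |u i - v i| < L) :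
    (castZ u : Site d L) = castZ v ↔ u = v := by
  constructor
  · intro huv
    funext i
    have hi := congrFun huv i
    simp only [castZ] at hi
    have hd : ((u i - v i : ℤ) : ZMod L) = 0 := by rw [Int.cast_sub, hi, sub_self]
    rw [ZMod.intCast_zmod_eq_zero_iff_dvd] at hd
    have := Int.eq_zero_of_abs_lt_dvd hd (h i)
    omega
  · rintro rfl; rfl


/-- FORWARD OCCURRENCE of the edge `(x, μ)` at letter `k`, decided on `ℤ^d`: the letter is `+μ` and the walker is
back at the base point. [folklore] -/
def Word.fwdOccZ (w : Word d) (μ : Fin d) (k : ℕ) : Prop := w[k]? = some (.fwd μ) ∧ w.dispZ k = 0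

/-- BACKWARD OCCURRENCE of `(x, μ)` at letter `k`: the letter is `−μ` taken from `x + e_μ`. [folklore] -/
def Word.bwdOccZ (w : Word d) (μ : Fin d) (k : ℕ) : Prop := w[k]? = some (.bwd μ) ∧ w.dispZ k = Pi.single μ 1

/-- `fwdOccZ` is decidable (word data only). [folklore] -/
instance (w : Word d) (μ : Fin d) (k : ℕ) : Decidable (w.fwdOccZ μ k) := inferInstanceAs (Decidable (_ ∧ _))
/-- `bwdOccZ` is decidable (word data only). [folklore] -/
instance (w : Word d) (μ : Fin d) (k : ℕ) : Decidable (w.bwdOccZ μ k) := inferInstanceAs (Decidable (_ ∧ _))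

/-- The word is SMALL for the torus: every partial displacement has sup-norm `≤ L − 2`, so that returns to the base
point (and to `x + e_μ`) on the torus are exactly the returns on `ℤ^d`. [folklore] -/
def Word.Small (w : Word d) (L : ℕ) : Prop := ∀ (k : ℕ) (i : Fin d), |w.dispZ k i| + 1 < L

/-- On a torus for which `w` is small, "back at `x`" is decided on `ℤ^d`. [folklore] -/
theorem Word.siteAt_eq_iff [NeZero L] {w : Word d} (hw : w.Small L) (x : Site d L) (k : ℕ) :
    Word.siteAt x w k = x ↔ w.dispZ k = 0 := by
  rw [Word.siteAt_eq_add_castZ, add_eq_left, ← castZ_zero, castZ_eq_castZ_iff]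
  intro i
  have := hw k i
  simp only [Pi.zero_apply, sub_zero]
  omega

/-- On a torus for which `w` is small, "at `x + e_μ`" is decided on `ℤ^d`. [folklore] -/
theorem Word.siteAt_sub_eq_iff [NeZero L] {w : Word d} (hw : w.Small L) (x : Site d L) (k : ℕ) (μ : Fin d) :
    Word.siteAt x w k - Pi.single μ 1 = x ↔ w.dispZ k = Pi.single μ 1 := by
  rw [sub_eq_iff_eq_add, Word.siteAt_eq_add_castZ, ← castZ_single, add_right_inj, castZ_eq_castZ_iff]
  intro i
  have := hw k i
  have h1 : |(Pi.single μ (1 : ℤ) : Fin d → ℤ) i| ≤ 1 := by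
    by_cases h : i = μ
    · subst h; simp
    · simp [h]
  have := abs_sub (w.dispZ k i) ((Pi.single μ (1 : ℤ) : Fin d → ℤ) i)
  omega

variable (ρ) in
/-- **Split terms decided on `ℤ^d`.** For a small word the `k`-th split term is the forward term if `fwdOccZ`, minus the
backward term if `bwdOccZ`, else `0` — all three conditions computable from the word alone. [folklore] -/
theorem splitTerm_eq_of_small [NeZero L] {w : Word d} (hw : w.Small L) (s : ℂ) (x : Site d L) (μ : Fin d)
    (U : GaugeConfig d L G) (k : ℕ) :
    splitTerm ρ s x μ U w k =
      if w.fwdOccZ μ k then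
        (ρ (wordHolonomy U x (w.take k))).trace * (ρ (wordHolonomy U (Word.siteAt x w k) (w.drop k))).trace -
          (s / N) * (ρ (wordHolonomy U x w)).trace
      else if w.bwdOccZ μ k then
        -((ρ (wordHolonomy U x (w.take (k + 1)))).trace *
            (ρ (wordHolonomy U (Word.siteAt x w (k + 1)) (w.drop (k + 1)))).trace -
          (s / N) * (ρ (wordHolonomy U x w)).trace)
      else 0 := by
  unfold splitTerm Word.fwdOccZ Word.bwdOccZ
  split
  · next hk => simp [hk]
  · next st hk =>
    cases st with
    | fwd ν =>
      by_cases hν : ν = μ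
      · subst hν
        simp only [Step.edge_fwd, Prod.mk.injEq, and_true, Step.isFwd_fwd, if_true, hk, Option.some.injEq, true_and,
          Word.siteAt_eq_iff hw, reduceCtorEq, false_and, if_false]
      · simp [hν, hk]
    | bwd ν =>
      by_cases hν : ν = μ
      · subst hν
        simp only [Step.edge_bwd, Prod.mk.injEq, and_true, Step.isFwd_bwd, Bool.false_eq_true, if_false, hk,
          Option.some.injEq, Word.siteAt_sub_eq_iff hw, reduceCtorEq, false_and, true_and]
      · simp [hν, hk]

variable [TopologicalSpace G] [IsTopologicalGroup G] [CompactSpace G] [MeasurableSpace G] [BorelSpace G]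
  (r : LatticeRep G)

/-- **THE LOOP-EQUATION SCHEMA (generic torus).**  For a word `w` closed at `x` and SMALL for the torus (every partial
displacement `≤ L − 2` in sup-norm) the single-link loop equation at `e = (x, μ)` reads
`Σ_{k : fwdOccZ} E[tr A_k tr B_k − (s/N) tr W] − Σ_{k : bwdOccZ} E[tr A'_k tr B'_k − (s/N) tr W] + (β/2)Σ_{ν≠μ,ε} E[plaqTerm_{ν,ε}] = 0`
where the occurrence sets are COMPUTED from the word on `ℤ^d` (`decide`), `A_k = hol w[0,k)`, `B_k = hol w[k,n)`,
`A'_k = hol w[0,k]`, `B'_k = hol w(k,n)` — each generator row (eng1/eng2 `leq/1`) is one instantiation. [folklore] -/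
theorem loopEquation_schema [NeZero L] (β : ℝ) (x : Site d L) (μ : Fin d) (s : ℂ) (w : Word d)
    (hw : Word.endpoint x w = x) (hsm : w.Small L) (hP : ∀ i j : Fin r.N, SDPair r β x μ x w (unitDir s i j)) :
    (∑ k ∈ (Finset.range w.length).filter (w.fwdOccZ μ),
        ∫ U, ((r.ρ (wordHolonomy U x (w.take k))).trace * (r.ρ (wordHolonomy U (Word.siteAt x w k) (w.drop k))).trace -
          (s / r.N) * (r.ρ (wordHolonomy U x w)).trace) ∂(wilsonMeasure (d := d) (L := L) r.ρ β)) -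
      (∑ k ∈ (Finset.range w.length).filter (w.bwdOccZ μ),
        ∫ U, ((r.ρ (wordHolonomy U x (w.take (k + 1)))).trace *
            (r.ρ (wordHolonomy U (Word.siteAt x w (k + 1)) (w.drop (k + 1)))).trace -
          (s / r.N) * (r.ρ (wordHolonomy U x w)).trace) ∂(wilsonMeasure (d := d) (L := L) r.ρ β)) +
      (β / 2 : ℂ) * ∑ ν ∈ Finset.univ.erase μ, ∑ ε : Bool,
        ∫ U, plaqTerm r.ρ s x μ U w ν ε ∂(wilsonMeasure (d := d) (L := L) r.ρ β) = 0 := by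
  have h := loopEquation_of_sdPair r β x μ s w hw hP
  have hsplit : ∀ k, ∫ U, splitTerm r.ρ s x μ U w k ∂(wilsonMeasure (d := d) (L := L) r.ρ β) =
      (if w.fwdOccZ μ k then
        ∫ U, ((r.ρ (wordHolonomy U x (w.take k))).trace * (r.ρ (wordHolonomy U (Word.siteAt x w k) (w.drop k))).trace -
          (s / r.N) * (r.ρ (wordHolonomy U x w)).trace) ∂(wilsonMeasure (d := d) (L := L) r.ρ β) else 0) -
      (if w.bwdOccZ μ k then
        ∫ U, ((r.ρ (wordHolonomy U x (w.take (k + 1)))).trace *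
            (r.ρ (wordHolonomy U (Word.siteAt x w (k + 1)) (w.drop (k + 1)))).trace -
          (s / r.N) * (r.ρ (wordHolonomy U x w)).trace) ∂(wilsonMeasure (d := d) (L := L) r.ρ β) else 0) := by
    intro k
    rw [integral_congr_ae (ae_of_all _ fun U => splitTerm_eq_of_small r.ρ hsm s x μ U k)]
    by_cases hf : w.fwdOccZ μ k
    · have hb : ¬ w.bwdOccZ μ k := fun hb => by
        have h1 := hf.1; have h2 := hb.1; rw [h1] at h2; simp at h2
      simp only [hf, hb, if_true, if_false, sub_zero]
    · by_cases hb : w.bwdOccZ μ k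
      · simp only [hf, hb, if_true, if_false, integral_neg, zero_sub]
      · simp only [hf, hb, if_false, integral_zero, sub_zero]
  simp_rw [hsplit, Finset.sum_sub_distrib, Finset.sum_ite, Finset.sum_const_zero, add_zero] at h
  exact h

/-- `SU(N)` form of the schema. [folklore] -/
theorem loopEquation_schema_specialUnitaryGroup [NeZero L] (N : ℕ) (β : ℝ) (x : Site d L) (μ : Fin d) (w : Word d)
    (hw : Word.endpoint x w = x) (hsm : w.Small L) :
    (∑ k ∈ (Finset.range w.length).filter (w.fwdOccZ μ),
        ∫ U, ((fundamentalRep (Fin N) (wordHolonomy U x (w.take k))).trace *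
            (fundamentalRep (Fin N) (wordHolonomy U (Word.siteAt x w k) (w.drop k))).trace -
          (1 / N) * (fundamentalRep (Fin N) (wordHolonomy U x w)).trace)
          ∂(wilsonMeasure (d := d) (L := L) (fundamentalRep (Fin N)) β)) -
      (∑ k ∈ (Finset.range w.length).filter (w.bwdOccZ μ),
        ∫ U, ((fundamentalRep (Fin N) (wordHolonomy U x (w.take (k + 1)))).trace *
            (fundamentalRep (Fin N) (wordHolonomy U (Word.siteAt x w (k + 1)) (w.drop (k + 1)))).trace -
          (1 / N) * (fundamentalRep (Fin N) (wordHolonomy U x w)).trace)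
          ∂(wilsonMeasure (d := d) (L := L) (fundamentalRep (Fin N)) β)) +
      (β / 2 : ℂ) * ∑ ν ∈ Finset.univ.erase μ, ∑ ε : Bool,
        ∫ U, plaqTerm (fundamentalRep (Fin N)) 1 x μ U w ν ε
          ∂(wilsonMeasure (d := d) (L := L) (fundamentalRep (Fin N)) β) = 0 :=
  loopEquation_schema (fundamentalLatticeRep N) β x μ 1 w hw hsm
    fun i j => sdPair_specialUnitaryGroup N β x μ x w _ (trace_unitDir_one i j)

/-- Example of the one-line use: the plaquette word in `d = 2` has forward occurrence set `{0}` and no backward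
occurrence (decided by `decide` on `ℤ²`). [folklore] -/
example : ((Finset.range 4).filter ((Word.plaquette (0 : Fin 2) 1).fwdOccZ 0)) = {0} ∧
    ((Finset.range 4).filter ((Word.plaquette (0 : Fin 2) 1).bwdOccZ 0)) = ∅ := by decide


/-- A DISPLACEMENT BOUND for a word: every partial displacement has sup-norm `≤ B` (decidable for explicit words, so
that `Small` follows from `B + 2 ≤ L` by `decide` + arithmetic). [folklore] -/
def Word.DispBound (w : Word d) (B : ℕ) : Prop := ∀ k ≤ w.length, ∀ i : Fin d, (w.dispZ k i).natAbs ≤ B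

/-- `DispBound` is decidable (bounded quantifiers over word data). [folklore] -/
instance (w : Word d) (B : ℕ) : Decidable (w.DispBound B) := by
  unfold Word.DispBound; infer_instance

/-- Displacements freeze after the end of the word. [folklore] -/
theorem Word.dispZ_of_length_le (w : Word d) {k : ℕ} (hk : w.length ≤ k) : w.dispZ k = w.dispZ w.length := by
  simp [Word.dispZ, List.take_of_length_le hk]

/-- `B + 2 ≤ L` and a displacement bound `B` make the word small for the torus `(ℤ/L)^d`. [folklore] -/
theorem Word.small_of_dispBound {w : Word d} {B : ℕ} (h : w.DispBound B) (hL : B + 2 ≤ L) : w.Small L := by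
  intro k i
  have hk : (w.dispZ k i).natAbs ≤ B := by
    by_cases hkl : k ≤ w.length
    · exact h k hkl i
    · rw [w.dispZ_of_length_le (le_of_not_ge hkl)]; exact h _ le_rfl i
  have h1 : |w.dispZ k i| ≤ (B : ℤ) := by rw [Int.abs_eq_natAbs]; exact_mod_cast hk
  have h2 : ((B : ℕ) : ℤ) + 2 ≤ (L : ℤ) := by exact_mod_cast hL
  omega

/-- Example: the plaquette word has displacement bound `1` (by `decide`), hence is small on every torus with `L ≥ 3`. [folklore] -/
example {L : ℕ} (hL : 3 ≤ L) : (Word.plaquette (0 : Fin 2) 1).Small L :=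
  Word.small_of_dispBound (by decide) hL


/-- Example (`d = 3`, GLYZ/KZ plaquette row): occurrence sets and displacement bound of `+0 +1 −0 −1` by `decide`. [folklore] -/
example : ((Finset.range 4).filter ((Word.plaquette (0 : Fin 3) 1).fwdOccZ 0)) = {0} ∧
    ((Finset.range 4).filter ((Word.plaquette (0 : Fin 3) 1).bwdOccZ 0)) = ∅ ∧
    (Word.plaquette (0 : Fin 3) 1).DispBound 1 := by decide

/-- Example (`d = 3`, a bent double plaquette `+0 +1 −0 −1 +0 +2 −0 −2`, the 3D analogue of the bowtie row): the edge
`(x, 0)` is traversed forward at letters `0` and `4`, never backward (by `decide`). [folklore] -/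
example : ((Finset.range 8).filter
      ((Word.plaquette (0 : Fin 3) 1 ++ Word.plaquette (0 : Fin 3) 2).fwdOccZ 0)) = {0, 4} ∧
    ((Finset.range 8).filter ((Word.plaquette (0 : Fin 3) 1 ++ Word.plaquette (0 : Fin 3) 2).bwdOccZ 0)) = ∅ ∧
    (Word.plaquette (0 : Fin 3) 1 ++ Word.plaquette (0 : Fin 3) 2).DispBound 1 := by decide

end Schema

end Summit.QuantumFields.GaugeBoot

end
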